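import Summits.CriticalPhenomena.Ising3D.Control2DFourPointBounds
import Summits.CriticalPhenomena.Ising3D.Control2DOpeConvergenceFree
import Mathlib.Analysis.SpecialFunctions.Pow.Real
import Mathlib.Analysis.SpecialFunctions.Sqrt
import Mathlib.Tactic.Linarith
import Mathlib.Tactic.Positivity
import Mathlib.Tactic.FieldSimp
import Mathlib.Tactic.Ring
import Mathlib.Tactic.NormNum
import HarnessLib

/-!
# Off the diagonal: the geometric–arithmetic sandwich and log-convexity of the typed four-point function
(cell `pub-ising3x`, seat controls-1 gen 49; PAPER §6.2 / Appendix E — CONTROL-ONLY; companion of `Control2DFourPoint`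
(E.1h), `Control2DFourPointBounds` (E.1i) and `Control2DOpeConvergenceFree` (E.1m))

HONEST FRAMING: lottery ticket; floor = tightest certified 3D Ising CFT bounds; no exact-solution
claim without a proof. CONTROL-ONLY (`d = 2`, global `sl(2) × sl(2)` blocks, `Δ_σ = s` an INPUT, axiom set `A2D′`);
nothing here is about `d = 3`, no certificate, functional or number of the record is touched, and no new hypothesis,
definition or named fact enters. PURE BLOCK ANALYSIS plus three datum-level corollaries.

WHAT THIS FILE ADDS. E.1h/E.1i control the four-point function `G(z,z̄) = 1 + Σ_i p_i g_i(z,z̄)` of a unitary typed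
datum OFF the diagonal of the real open square only by MONOTONE DOMINATION, `g(z,z̄) ≤ g(max, max)`
(`globalBlock_le_diag`, `fourPoint_mono`). Here the off-diagonal values are pinned between two DIAGONAL quantities:

* `chiralBlock_mono_right` — `k_{2h}(x) ≤ k_{2h}(y)` for `0 < x ≤ y < 1`, `h ≥ 0` (non-negative series);
* **`chiralBlock_geom_sq_le`** — `k_{2h}(√(xy))² ≤ k_{2h}(x)·k_{2h}(y)`: every chiral block is LOG-CONVEX in `log x` on
  `(0,1)` (termwise AM–GM with a free parameter `t > 0` on the non-negative series `Σ_m a_m(h) x^{h+m}`,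
  `two_mul_chiralBlock_sqrt_le`, then `t = C/A`, `sq_le_mul_of_forall_param`);
* **`globalBlock_geomMean_le`** — `g_{Δ,ℓ}(√(z z̄), √(z z̄)) ≤ g_{Δ,ℓ}(z, z̄)` for a unitary label `ℓ ≤ Δ`: on every hyperbola
  `z·z̄ = const` of the square the block is MINIMAL on the diagonal (`(k_h(m)k_h̄(m))² ≤ (k_h(z)k_h̄(z̄))·(k_h̄(z)k_h(z̄))` by
  log-convexity twice, then `2C ≤ A + B`);
* **`globalBlock_le_arithMean`** — `g_{Δ,ℓ}(z, z̄) ≤ ½ (g_{Δ,ℓ}(z,z) + g_{Δ,ℓ}(z̄,z̄))`, i.e.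
  `(k_h(z) − k_h(z̄))·(k_h̄(z) − k_h̄(z̄)) ≥ 0` (both factors of one sign by monotonicity) — SHARPER than monotone
  domination (the mean of the two diagonal values instead of the larger one);
* `globalBlock_diag_geom_sq_le` — `g(√(xy),√(xy))² ≤ g(x,x)·g(y,y)` on the diagonal;
* for unitary data with convergent expansion (`OpeConvergent`; unconditional for solutions of the typed sum rule at
  `s > 0` by E.1m's `opeConvergent_free`): **`CrossingData.fourPoint_geomMean_le`** `G(√(z z̄), √(z z̄)) ≤ G(z, z̄)`,
  **`CrossingData.fourPoint_le_arithMean`** `G(z, z̄) ≤ ½ (G(z,z) + G(z̄,z̄))`, and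
  **`CrossingData.fourPoint_diag_logConvex`** `(G(√(xy),√(xy)) − 1)² ≤ (G(x,x) − 1)·(G(y,y) − 1)` — `t ↦ G(e^{-t},e^{-t}) − 1`
  is LOG-CONVEX (it is the Laplace transform of the non-negative diagonal-states measure of E.1u); the sandwich for
  solutions `CrossingData.fourPoint_sandwich`, and with E.1i's closed-form diagonal envelope under a gap the closed-form
  OFF-diagonal envelope `CrossingData.fourPoint_le_arithMean_closed`; record row at `Δ_σ = 1/8`
  (`record_fourPoint_sandwich`).

NOT claimed: the Cauchy–Schwarz form `(G(z,z̄) − 1)² ≤ (G(z,z) − 1)(G(z̄,z̄) − 1)` ACROSS the pair (false for a single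
pair monomial by AM–GM; only the arithmetic mean is a theorem of positivity alone); strict inequalities; complex `z` /
Lorentzian kinematics; `s = 0`; Virasoro; `d = 3`; any bound on `Δ_ε`, `c` or `λ²`; nothing of the record touched.
References (CONTEXT, not inputs): Dolan–Osborn, Nucl. Phys. B 678 (2004) 491, §3 [cite: DolanOsborn2004, §3];
Rattazzi–Rychkov–Tonni–Vichi, JHEP 12 (2008) 031, §3 [cite: RattazziEtAl2008, §3]. Tree inputs by name:
`hasSum_chiralBlock`, `chiralCoeff_nonneg` (`Control2DTermwise`); `chiralBlock_nonneg` (`Control2DNonVacuity`);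
`globalBlock_swap`, `globalBlock_nonneg`, `CrossingData.fourPoint`, `OpeConvergent`, `opeConvergent_of_lowerBound`
(`Control2DFourPoint`); `CrossingData.fourPoint_diag_upper_closed`, `lowerBound_of_location` (`Control2DFourPointBounds`);
`CrossingData.opeConvergent_free` (`Control2DOpeConvergenceFree`); `twoSided_2d_kernel099` (the record, instantiation
only). Mathlib: `hasSum_le`, `HasSum.mul_left/.div_const`, `Real.sqrt_eq_rpow`, `Real.rpow_mul`, `Real.mul_rpow`,
`Real.sqrt_lt'`, `two_mul_le_add_sq`, `Real.sqrt_mul`, `Real.sq_sqrt`, `Real.sqrt_sq`, `le_div_iff₀`.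
-/

namespace Summit.CriticalPhenomena.Ising3D.Control2D

open Set
open Literature.MathematicalPhysics.QuantumFieldTheory.ConformalBootstrap3D

/-! ### Two elementary inequalities with a free parameter -/

/-- If `C² ≤ A·B` with `A, B, C ≥ 0`, then `2C ≤ t·A + B/t` for every `t > 0` (`2C ≤ 2√(AB) = 2√(tA)·√(B/t)`).
[folklore] -/
theorem two_mul_le_param_of_sq_le {A B C t : ℝ} (hA : 0 ≤ A) (hB : 0 ≤ B) (hC : 0 ≤ C) (h : C ^ 2 ≤ A * B)
    (ht : 0 < t) : 2 * C ≤ t * A + B / t := by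
  have htA : 0 ≤ t * A := mul_nonneg ht.le hA
  have hBt : 0 ≤ B / t := div_nonneg hB ht.le
  have h1 : C ≤ Real.sqrt (t * A) * Real.sqrt (B / t) := by
    rw [← Real.sqrt_mul htA, ← Real.sqrt_sq hC]
    apply Real.sqrt_le_sqrt
    have e : t * A * (B / t) = A * B := by field_simp
    rw [e]
    exact h
  have h2 := two_mul_le_add_sq (Real.sqrt (t * A)) (Real.sqrt (B / t))
  rw [Real.sq_sqrt htA, Real.sq_sqrt hBt] at h2
  nlinarith [h1, h2, Real.sqrt_nonneg (t * A), Real.sqrt_nonneg (B / t)]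

/-- Conversely: if `A, B, C ≥ 0` and `2C ≤ t·A + B/t` for EVERY `t > 0`, then `C² ≤ A·B` (take `t = C/A`; the
degenerate cases `A = 0` or `C = 0` directly). [folklore] -/
theorem sq_le_mul_of_forall_param {A B C : ℝ} (hA : 0 ≤ A) (hB : 0 ≤ B) (hC : 0 ≤ C)
    (h : ∀ t : ℝ, 0 < t → 2 * C ≤ t * A + B / t) : C ^ 2 ≤ A * B := by
  rcases hC.eq_or_lt with h0 | hCpos
  · rw [← h0]
    simpa using mul_nonneg hA hB
  rcases hA.eq_or_lt with hA0 | hApos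
  · -- `A = 0`: `2C ≤ B/t` for all `t > 0` is impossible for `C > 0` (take `t = B/C + 1`)
    exfalso
    have ht : 0 < B / C + 1 := by positivity
    have h1 := h (B / C + 1) ht
    rw [← hA0, mul_zero, zero_add] at h1
    have h2 : B / (B / C + 1) ≤ C := by
      rw [div_le_iff₀ ht]
      have e : C * (B / C + 1) = B + C := by field_simp
      rw [e]
      linarith
    linarith
  · have h1 := h (C / A) (div_pos hCpos hApos)
    have e1 : C / A * A = C := div_mul_cancel₀ C hApos.ne'
    have e2 : B / (C / A) = A * B / C := by
      field_simp
    rw [e1, e2] at h1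
    have h2 : C ≤ A * B / C := by linarith
    rw [le_div_iff₀ hCpos] at h2
    rw [sq]
    exact h2

/-! ### `√(xy)` in the square, and two `rpow` identities -/

/-- The geometric mean of two points of `(0,1)` lies in `(0,1)`. [folklore] -/
theorem sqrt_mul_mem_Ioo {x y : ℝ} (hx : x ∈ Ioo (0 : ℝ) 1) (hy : y ∈ Ioo (0 : ℝ) 1) :
    Real.sqrt (x * y) ∈ Ioo (0 : ℝ) 1 := by
  refine ⟨Real.sqrt_pos.mpr (mul_pos hx.1 hy.1), ?_⟩
  rw [Real.sqrt_lt' one_pos, one_pow]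
  exact mul_lt_one_of_nonneg_of_lt_one_left hx.1.le hx.2 hy.2.le

/-- `√(xy)^e = x^{e/2}·y^{e/2}` for `x, y ≥ 0`. [folklore] -/
theorem sqrt_mul_rpow {x y : ℝ} (hx : 0 ≤ x) (hy : 0 ≤ y) (e : ℝ) :
    Real.sqrt (x * y) ^ e = x ^ (e / 2) * y ^ (e / 2) := by
  rw [Real.sqrt_eq_rpow, ← Real.rpow_mul (mul_nonneg hx hy), show (1 : ℝ) / 2 * e = e / 2 by ring,
    Real.mul_rpow hx hy]

/-- `x^e = (x^{e/2})²` for `x ≥ 0`. [folklore] -/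
theorem rpow_eq_rpow_half_sq {x : ℝ} (hx : 0 ≤ x) (e : ℝ) : x ^ e = (x ^ (e / 2)) ^ 2 := by
  rw [← Real.rpow_natCast (x ^ (e / 2)) 2, ← Real.rpow_mul hx]
  congr 1
  push_cast
  ring

/-! ### The chiral block is monotone and log-convex in the variable -/

/-- **Monotonicity of the chiral block**: `k_{2h}(x) ≤ k_{2h}(y)` for `0 < x ≤ y < 1`, `h ≥ 0` — every term
`a_m(h) x^{h+m}` of the series is non-negative and increasing. (The tree's `globalBlock_mono` is the two-variable
statement; this is its chiral half.) [folklore] -/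
theorem chiralBlock_mono_right {h : ℝ} (hh : 0 ≤ h) {x y : ℝ} (hx : 0 < x) (hxy : x ≤ y) (hy : y < 1) :
    chiralBlock h x ≤ chiralBlock h y :=
  hasSum_le (fun m => mul_le_mul_of_nonneg_left
      (Real.rpow_le_rpow hx.le hxy (add_nonneg hh (Nat.cast_nonneg m))) (chiralCoeff_nonneg hh m))
    (hasSum_chiralBlock h hx (lt_of_le_of_lt hxy hy)) (hasSum_chiralBlock h (lt_of_lt_of_le hx hxy) hy)

/-- Termwise AM–GM for the chiral series at the geometric mean: for `t > 0`,
`2·a_m(h)·√(xy)^{h+m} ≤ t·a_m(h)x^{h+m} + a_m(h)y^{h+m}/t`. [folklore] -/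
theorem chiral_term_amgm {h : ℝ} (hh : 0 ≤ h) {x y t : ℝ} (hx : 0 ≤ x) (hy : 0 ≤ y) (ht : 0 < t) (m : ℕ) :
    2 * (chiralCoeff h m * Real.sqrt (x * y) ^ (h + (m : ℝ))) ≤
      t * (chiralCoeff h m * x ^ (h + (m : ℝ))) + chiralCoeff h m * y ^ (h + (m : ℝ)) / t := by
  have ha := chiralCoeff_nonneg hh m
  rw [sqrt_mul_rpow hx hy, rpow_eq_rpow_half_sq hx (h + (m : ℝ)), rpow_eq_rpow_half_sq hy (h + (m : ℝ))]
  -- AM–GM with a free parameter: `2uv ≤ t·u² + v²/t` (`= (tu − v)²/t ≥ 0`)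
  have key : ∀ u v : ℝ, 2 * (u * v) ≤ t * u ^ 2 + v ^ 2 / t := fun u v => by
    have h0 : 0 ≤ (t * u - v) ^ 2 / t := div_nonneg (sq_nonneg _) ht.le
    have e : t * u ^ 2 + v ^ 2 / t - 2 * (u * v) = (t * u - v) ^ 2 / t := by
      field_simp
      ring
    linarith
  have e : t * (chiralCoeff h m * (x ^ ((h + (m : ℝ)) / 2)) ^ 2) +
      chiralCoeff h m * (y ^ ((h + (m : ℝ)) / 2)) ^ 2 / t =
      chiralCoeff h m * (t * (x ^ ((h + (m : ℝ)) / 2)) ^ 2 + (y ^ ((h + (m : ℝ)) / 2)) ^ 2 / t) := by ring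
  rw [e]
  calc 2 * (chiralCoeff h m * (x ^ ((h + (m : ℝ)) / 2) * y ^ ((h + (m : ℝ)) / 2)))
      = chiralCoeff h m * (2 * (x ^ ((h + (m : ℝ)) / 2) * y ^ ((h + (m : ℝ)) / 2))) := by ring
    _ ≤ _ := mul_le_mul_of_nonneg_left (key _ _) ha

/-- **AM–GM with a free parameter for the chiral block**: `2·k_{2h}(√(xy)) ≤ t·k_{2h}(x) + k_{2h}(y)/t` for every
`t > 0`, `h ≥ 0`, `x, y ∈ (0,1)` (termwise, `hasSum_le`). [folklore] -/
theorem two_mul_chiralBlock_sqrt_le {h : ℝ} (hh : 0 ≤ h) {x y t : ℝ} (hx : x ∈ Ioo (0 : ℝ) 1)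
    (hy : y ∈ Ioo (0 : ℝ) 1) (ht : 0 < t) :
    2 * chiralBlock h (Real.sqrt (x * y)) ≤ t * chiralBlock h x + chiralBlock h y / t := by
  have hm := sqrt_mul_mem_Ioo hx hy
  have Hm := (hasSum_chiralBlock h hm.1 hm.2).mul_left 2
  have Hx := (hasSum_chiralBlock h hx.1 hx.2).mul_left t
  have Hy := (hasSum_chiralBlock h hy.1 hy.2).div_const t
  exact hasSum_le (fun m => chiral_term_amgm hh hx.1.le hy.1.le ht m) Hm (Hx.add Hy)

/-- **Log-convexity of the chiral block in `log x`**: `k_{2h}(√(xy))² ≤ k_{2h}(x)·k_{2h}(y)` for `h ≥ 0`,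
`x, y ∈ (0,1)` — `x ↦ k_{2h}(x)` is the Laplace transform (in `t = log(1/x)`) of a non-negative discrete measure.
[folklore] -/
theorem chiralBlock_geom_sq_le {h : ℝ} (hh : 0 ≤ h) {x y : ℝ} (hx : x ∈ Ioo (0 : ℝ) 1) (hy : y ∈ Ioo (0 : ℝ) 1) :
    chiralBlock h (Real.sqrt (x * y)) ^ 2 ≤ chiralBlock h x * chiralBlock h y :=
  sq_le_mul_of_forall_param (chiralBlock_nonneg hh hx) (chiralBlock_nonneg hh hy)
    (chiralBlock_nonneg hh (sqrt_mul_mem_Ioo hx hy)) fun _ ht => two_mul_chiralBlock_sqrt_le hh hx hy ht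

/-! ### The global block: geometric mean below, arithmetic mean above -/

/-- On the diagonal the parity-symmetrised block is `g_{Δ,ℓ}(x,x) = 2·k_{2h}(x)·k_{2h̄}(x)`. [cite: DolanOsborn2004, §3] -/
theorem globalBlock_diag_eq (Δ : ℝ) (ℓ : ℕ) (x : ℝ) :
    globalBlock Δ ℓ x x = 2 * (chiralBlock ((Δ + ℓ) / 2) x * chiralBlock ((Δ - ℓ) / 2) x) := by
  unfold globalBlock
  ring

/-- The product inequality behind the sandwich: for a unitary label and `m = √(z z̄)`,
`(k_h(m)·k_h̄(m))² ≤ (k_h(z)·k_h̄(z̄)) · (k_h̄(z)·k_h(z̄))` (log-convexity of each chiral factor). [folklore] -/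
theorem chiral_prod_geom_sq_le {Δ : ℝ} {ℓ : ℕ} (hΔ : (ℓ : ℝ) ≤ Δ) {z zb : ℝ} (hz : z ∈ Ioo (0 : ℝ) 1)
    (hzb : zb ∈ Ioo (0 : ℝ) 1) :
    (chiralBlock ((Δ + ℓ) / 2) (Real.sqrt (z * zb)) * chiralBlock ((Δ - ℓ) / 2) (Real.sqrt (z * zb))) ^ 2 ≤
      (chiralBlock ((Δ + ℓ) / 2) z * chiralBlock ((Δ - ℓ) / 2) zb) *
        (chiralBlock ((Δ - ℓ) / 2) z * chiralBlock ((Δ + ℓ) / 2) zb) := by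
  have hℓ : (0 : ℝ) ≤ ℓ := Nat.cast_nonneg ℓ
  have hh₁ : 0 ≤ (Δ + ℓ) / 2 := by linarith
  have hh₂ : 0 ≤ (Δ - ℓ) / 2 := by linarith
  have h1 := chiralBlock_geom_sq_le hh₁ hz hzb
  have h2 := chiralBlock_geom_sq_le hh₂ hz hzb
  have hn₁ := mul_nonneg (chiralBlock_nonneg hh₁ hz) (chiralBlock_nonneg hh₁ hzb)
  calc (chiralBlock ((Δ + ℓ) / 2) (Real.sqrt (z * zb)) * chiralBlock ((Δ - ℓ) / 2) (Real.sqrt (z * zb))) ^ 2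
      = chiralBlock ((Δ + ℓ) / 2) (Real.sqrt (z * zb)) ^ 2 *
          chiralBlock ((Δ - ℓ) / 2) (Real.sqrt (z * zb)) ^ 2 := by ring
    _ ≤ (chiralBlock ((Δ + ℓ) / 2) z * chiralBlock ((Δ + ℓ) / 2) zb) *
          (chiralBlock ((Δ - ℓ) / 2) z * chiralBlock ((Δ - ℓ) / 2) zb) :=
        mul_le_mul h1 h2 (sq_nonneg _) hn₁
    _ = _ := by ring

/-- **The geometric-mean lower bound**: for a unitary label `ℓ ≤ Δ` and `(z, z̄)` in the open square,
`g_{Δ,ℓ}(√(z z̄), √(z z̄)) ≤ g_{Δ,ℓ}(z, z̄)` — on every hyperbola `z·z̄ = const` the block (Dolan–Osborn 2004 §3, in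
closed form) is minimal on the diagonal. AM–GM after log-convexity of each chiral factor. [folklore] -/
theorem globalBlock_geomMean_le {Δ : ℝ} {ℓ : ℕ} (hΔ : (ℓ : ℝ) ≤ Δ) {z zb : ℝ} (hz : z ∈ Ioo (0 : ℝ) 1)
    (hzb : zb ∈ Ioo (0 : ℝ) 1) :
    globalBlock Δ ℓ (Real.sqrt (z * zb)) (Real.sqrt (z * zb)) ≤ globalBlock Δ ℓ z zb := by
  have hℓ : (0 : ℝ) ≤ ℓ := Nat.cast_nonneg ℓ
  have hh₁ : 0 ≤ (Δ + ℓ) / 2 := by linarith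
  have hh₂ : 0 ≤ (Δ - ℓ) / 2 := by linarith
  have hm := sqrt_mul_mem_Ioo hz hzb
  have hA : 0 ≤ chiralBlock ((Δ + ℓ) / 2) z * chiralBlock ((Δ - ℓ) / 2) zb :=
    mul_nonneg (chiralBlock_nonneg hh₁ hz) (chiralBlock_nonneg hh₂ hzb)
  have hB : 0 ≤ chiralBlock ((Δ - ℓ) / 2) z * chiralBlock ((Δ + ℓ) / 2) zb :=
    mul_nonneg (chiralBlock_nonneg hh₂ hz) (chiralBlock_nonneg hh₁ hzb)
  have hC : 0 ≤ chiralBlock ((Δ + ℓ) / 2) (Real.sqrt (z * zb)) * chiralBlock ((Δ - ℓ) / 2) (Real.sqrt (z * zb)) :=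
    mul_nonneg (chiralBlock_nonneg hh₁ hm) (chiralBlock_nonneg hh₂ hm)
  have h := two_mul_le_param_of_sq_le hA hB hC (chiral_prod_geom_sq_le hΔ hz hzb) one_pos
  rw [one_mul, div_one] at h
  rw [globalBlock_diag_eq]
  unfold globalBlock
  exact h

/-- **Log-convexity of the block on the diagonal**: `g_{Δ,ℓ}(√(xy),√(xy))² ≤ g_{Δ,ℓ}(x,x)·g_{Δ,ℓ}(y,y)` for a unitary
label and `x, y ∈ (0,1)`. [folklore] -/
theorem globalBlock_diag_geom_sq_le {Δ : ℝ} {ℓ : ℕ} (hΔ : (ℓ : ℝ) ≤ Δ) {x y : ℝ} (hx : x ∈ Ioo (0 : ℝ) 1)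
    (hy : y ∈ Ioo (0 : ℝ) 1) :
    globalBlock Δ ℓ (Real.sqrt (x * y)) (Real.sqrt (x * y)) ^ 2 ≤ globalBlock Δ ℓ x x * globalBlock Δ ℓ y y := by
  have h := chiral_prod_geom_sq_le hΔ hx hy
  simp only [globalBlock_diag_eq]
  nlinarith [h]

/-- **Arithmetic-mean domination**: for a unitary label `ℓ ≤ Δ` and `(z, z̄)` in the open square,
`g_{Δ,ℓ}(z, z̄) ≤ ½ (g_{Δ,ℓ}(z,z) + g_{Δ,ℓ}(z̄,z̄))` — `(k_h(z) − k_h(z̄))·(k_h̄(z) − k_h̄(z̄)) ≥ 0`, both factors having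
the sign of `z − z̄` (`chiralBlock_mono_right`): the rearrangement inequality. Sharper than `globalBlock_le_diag` (the
mean instead of the maximum). [folklore] -/
theorem globalBlock_le_arithMean {Δ : ℝ} {ℓ : ℕ} (hΔ : (ℓ : ℝ) ≤ Δ) {z zb : ℝ} (hz : z ∈ Ioo (0 : ℝ) 1)
    (hzb : zb ∈ Ioo (0 : ℝ) 1) :
    globalBlock Δ ℓ z zb ≤ (globalBlock Δ ℓ z z + globalBlock Δ ℓ zb zb) / 2 := by
  have hℓ : (0 : ℝ) ≤ ℓ := Nat.cast_nonneg ℓ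
  have hh₁ : 0 ≤ (Δ + ℓ) / 2 := by linarith
  have hh₂ : 0 ≤ (Δ - ℓ) / 2 := by linarith
  wlog hle : z ≤ zb generalizing z zb
  · have h := this hzb hz (le_of_not_ge hle)
    rw [globalBlock_swap] at h
    linarith
  have h1 : chiralBlock ((Δ + ℓ) / 2) z ≤ chiralBlock ((Δ + ℓ) / 2) zb :=
    chiralBlock_mono_right hh₁ hz.1 hle hzb.2
  have h2 : chiralBlock ((Δ - ℓ) / 2) z ≤ chiralBlock ((Δ - ℓ) / 2) zb :=
    chiralBlock_mono_right hh₂ hz.1 hle hzb.2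
  have key : 0 ≤ (chiralBlock ((Δ + ℓ) / 2) zb - chiralBlock ((Δ + ℓ) / 2) z) *
      (chiralBlock ((Δ - ℓ) / 2) zb - chiralBlock ((Δ - ℓ) / 2) z) :=
    mul_nonneg (sub_nonneg.mpr h1) (sub_nonneg.mpr h2)
  unfold globalBlock
  nlinarith [key]

namespace CrossingData

variable {D : CrossingData} {s : ℝ}

/-! ### The typed four-point function off the diagonal -/

/-- **Geometric-mean lower bound for the four-point function**: for unitary data with convergent expansion and
`(z, z̄)` in the open square, `G(√(z z̄), √(z z̄)) ≤ G(z, z̄)` — on every hyperbola `z·z̄ = const` the typed four-point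
function (`G` of Rattazzi–Rychkov–Tonni–Vichi 2008 §3 eq. (3.3), typed as `CrossingData.fourPoint`) is MINIMAL on the
diagonal (termwise `globalBlock_geomMean_le`, `p_i ≥ 0`). [folklore] -/
theorem fourPoint_geomMean_le (hU : D.IsUnitary) (hconv : D.OpeConvergent) {z zb : ℝ} (hz : z ∈ Ioo (0 : ℝ) 1)
    (hzb : zb ∈ Ioo (0 : ℝ) 1) :
    D.fourPoint (Real.sqrt (z * zb)) (Real.sqrt (z * zb)) ≤ D.fourPoint z zb := by
  have hm := sqrt_mul_mem_Ioo hz hzb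
  have h := hasSum_le (fun i => mul_le_mul_of_nonneg_left (globalBlock_geomMean_le (hU i).2.1 hz hzb) (hU i).2.2)
    (hconv _ _ hm hm).hasSum (hconv z zb hz hzb).hasSum
  unfold fourPoint
  linarith

/-- **Arithmetic-mean upper bound for the four-point function**: for unitary data with convergent expansion and
`(z, z̄)` in the open square, `G(z, z̄) ≤ ½ (G(z,z) + G(z̄,z̄))` (termwise `globalBlock_le_arithMean`, `p_i ≥ 0`) —
sharper than E.1i's monotone domination `G(z,z̄) ≤ G(max,max)` (`fourPoint_mono`). [folklore] -/
theorem fourPoint_le_arithMean (hU : D.IsUnitary) (hconv : D.OpeConvergent) {z zb : ℝ} (hz : z ∈ Ioo (0 : ℝ) 1)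
    (hzb : zb ∈ Ioo (0 : ℝ) 1) :
    D.fourPoint z zb ≤ (D.fourPoint z z + D.fourPoint zb zb) / 2 := by
  have hle : ∀ i, D.p i * globalBlock (D.Δ i) (D.spin i) z zb ≤
      (D.p i * globalBlock (D.Δ i) (D.spin i) z z + D.p i * globalBlock (D.Δ i) (D.spin i) zb zb) / 2 := by
    intro i
    have h := mul_le_mul_of_nonneg_left (globalBlock_le_arithMean (hU i).2.1 hz hzb) (hU i).2.2
    linarith
  have h := hasSum_le hle (hconv z zb hz hzb).hasSum
    (((hconv z z hz hz).hasSum.add (hconv zb zb hzb hzb).hasSum).div_const 2)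
  unfold fourPoint
  linarith

/-- **Log-convexity of the diagonal four-point function**: for unitary data with convergent expansion and
`x, y ∈ (0,1)`, `(G(√(xy),√(xy)) − 1)² ≤ (G(x,x) − 1)·(G(y,y) − 1)` — `t ↦ G(e^{-t},e^{-t}) − 1` is log-convex (for
every `t > 0`, termwise `2 p_i g_i(m,m) ≤ t p_i g_i(x,x) + p_i g_i(y,y)/t` from `globalBlock_diag_geom_sq_le`, summed, then
`sq_le_mul_of_forall_param`): log-convexity of the Laplace transform of a positive measure. [folklore] -/
theorem fourPoint_diag_logConvex (hU : D.IsUnitary) (hconv : D.OpeConvergent) {x y : ℝ} (hx : x ∈ Ioo (0 : ℝ) 1)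
    (hy : y ∈ Ioo (0 : ℝ) 1) :
    (D.fourPoint (Real.sqrt (x * y)) (Real.sqrt (x * y)) - 1) ^ 2 ≤
      (D.fourPoint x x - 1) * (D.fourPoint y y - 1) := by
  have hm := sqrt_mul_mem_Ioo hx hy
  have hG : ∀ u v : ℝ, D.fourPoint u v - 1 = ∑' i, D.p i * globalBlock (D.Δ i) (D.spin i) u v := fun u v => by
    unfold fourPoint; ring
  have hA : 0 ≤ D.fourPoint x x - 1 := by
    rw [hG]; exact tsum_nonneg fun i => mul_nonneg (hU i).2.2 (globalBlock_nonneg (hU i).2.1 hx hx)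
  have hB : 0 ≤ D.fourPoint y y - 1 := by
    rw [hG]; exact tsum_nonneg fun i => mul_nonneg (hU i).2.2 (globalBlock_nonneg (hU i).2.1 hy hy)
  have hC : 0 ≤ D.fourPoint (Real.sqrt (x * y)) (Real.sqrt (x * y)) - 1 := by
    rw [hG]; exact tsum_nonneg fun i => mul_nonneg (hU i).2.2 (globalBlock_nonneg (hU i).2.1 hm hm)
  refine sq_le_mul_of_forall_param hA hB hC fun t ht => ?_
  have hle : ∀ i, 2 * (D.p i * globalBlock (D.Δ i) (D.spin i) (Real.sqrt (x * y)) (Real.sqrt (x * y))) ≤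
      t * (D.p i * globalBlock (D.Δ i) (D.spin i) x x) + D.p i * globalBlock (D.Δ i) (D.spin i) y y / t := by
    intro i
    have hp := (hU i).2.2
    have hgx := globalBlock_nonneg (hU i).2.1 hx hx
    have hgy := globalBlock_nonneg (hU i).2.1 hy hy
    have hgm := globalBlock_nonneg (hU i).2.1 hm hm
    have h := two_mul_le_param_of_sq_le hgx hgy hgm (globalBlock_diag_geom_sq_le (hU i).2.1 hx hy) ht
    have h' := mul_le_mul_of_nonneg_left h hp
    have e : D.p i * (t * globalBlock (D.Δ i) (D.spin i) x x + globalBlock (D.Δ i) (D.spin i) y y / t) =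
        t * (D.p i * globalBlock (D.Δ i) (D.spin i) x x) + D.p i * globalBlock (D.Δ i) (D.spin i) y y / t := by
      ring
    linarith
  have h := hasSum_le hle ((hconv _ _ hm hm).hasSum.mul_left 2)
    (((hconv x x hx hx).hasSum.mul_left t).add ((hconv y y hy hy).hasSum.div_const t))
  rw [hG, hG, hG]
  exact h

/-- **The sandwich for every unitary solution of the typed sum rule at `Δ_σ = s > 0`** (OPE convergence is
unconditional, E.1m `opeConvergent_free`): for `(z, z̄)` in the open square,
`G(√(z z̄), √(z z̄)) ≤ G(z, z̄) ≤ ½ (G(z,z) + G(z̄,z̄))`, and the diagonal function is log-convex. [folklore] -/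
theorem fourPoint_sandwich (hU : D.IsUnitary) (hC : D.SatisfiesCrossing s) (hs : 0 < s) {z zb : ℝ}
    (hz : z ∈ Ioo (0 : ℝ) 1) (hzb : zb ∈ Ioo (0 : ℝ) 1) :
    D.fourPoint (Real.sqrt (z * zb)) (Real.sqrt (z * zb)) ≤ D.fourPoint z zb ∧
      D.fourPoint z zb ≤ (D.fourPoint z z + D.fourPoint zb zb) / 2 ∧
      (D.fourPoint (Real.sqrt (z * zb)) (Real.sqrt (z * zb)) - 1) ^ 2 ≤
        (D.fourPoint z z - 1) * (D.fourPoint zb zb - 1) :=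
  ⟨fourPoint_geomMean_le hU (opeConvergent_free hU hC hs) hz hzb,
    fourPoint_le_arithMean hU (opeConvergent_free hU hC hs) hz hzb,
    fourPoint_diag_logConvex hU (opeConvergent_free hU hC hs) hz hzb⟩

/-- **Closed-form off-diagonal envelope under a gap** (E.1i's diagonal envelope, averaged): for unitary solutions with
all labels `Δ_i ≥ τ₀ > 2s` and `z, z̄ ∈ (1/2, 1)`, with `ρ(y) = (1-y)/y`,
`G(z,z̄) ≤ 1 + ½ [ (1-ρ(z)^{2s})/(ρ(z)^{2s} - ρ(z)^{τ₀}) + (1-ρ(z̄)^{2s})/(ρ(z̄)^{2s} - ρ(z̄)^{τ₀}) ]`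
(E.1i's `fourPoint_diag_upper_closed` [cite: RattazziEtAl2008, §3], averaged by `fourPoint_le_arithMean`; E.1i's
`fourPoint_le_diag_upper` has the envelope at `max(z,z̄)` instead of the mean). [folklore] -/
theorem fourPoint_le_arithMean_closed (hU : D.IsUnitary) (hC : D.SatisfiesCrossing s) {τ₀ : ℝ}
    (hτ : ∀ i, τ₀ ≤ D.Δ i) (hτ₀ : 2 * s < τ₀) {z zb : ℝ} (hz2 : 1 / 2 < z) (hz1 : z < 1) (hzb2 : 1 / 2 < zb)
    (hzb1 : zb < 1) :
    D.fourPoint z zb ≤ 1 + ((1 - ((1 - z) / z) ^ (2 * s)) / (((1 - z) / z) ^ (2 * s) - ((1 - z) / z) ^ τ₀) +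
      (1 - ((1 - zb) / zb) ^ (2 * s)) / (((1 - zb) / zb) ^ (2 * s) - ((1 - zb) / zb) ^ τ₀)) / 2 := by
  have hconv := opeConvergent_of_lowerBound hU hC hτ hτ₀
  have hz : z ∈ Ioo (0 : ℝ) 1 := ⟨by linarith, hz1⟩
  have hzb : zb ∈ Ioo (0 : ℝ) 1 := ⟨by linarith, hzb1⟩
  have h0 := fourPoint_le_arithMean hU hconv hz hzb
  have h1 := fourPoint_diag_upper_closed hU hC hτ hτ₀ hz2 hz1
  have h2 := fourPoint_diag_upper_closed hU hC hτ hτ₀ hzb2 hzb1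
  linarith

end CrossingData

/-! ### The record's class at `Δ_σ = 1/8` -/

/-- **Record row (instantiation only).** At `Δ_σ = 1/8`, for every window `w`: a unitary solution with spin 2 in
`{2} ∪ [3,∞)` and scalars in `{x} ∪ [2,∞)`, `w ≤ x`, satisfies at every `(z, z̄)` of the open square
`G(√(z z̄), √(z z̄)) ≤ G(z, z̄) ≤ ½ (G(z,z) + G(z̄,z̄))` and, for `z, z̄ ∈ (1/2,1)`, the closed-form envelope with
`τ₀ = 99/100` (the record's `x > 0.99` via `twoSided_2d_kernel099`; all labels `≥ 0.99 > 1/4`). CONTROL-ONLY; no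
certificate; nothing of the record is touched. [folklore] -/
theorem record_fourPoint_sandwich (w : ℝ) (D : CrossingData) (hU : D.IsUnitary)
    (hC : D.SatisfiesCrossing (1 / 8)) (hT : D.SpinTwoIn ({2} ∪ Ici (2 + 1))) (x : ℝ) (hwx : w ≤ x)
    (hS : D.ScalarsIn ({x} ∪ Ici 2)) {z zb : ℝ} (hz : z ∈ Ioo (0 : ℝ) 1) (hzb : zb ∈ Ioo (0 : ℝ) 1) :
    (D.fourPoint (Real.sqrt (z * zb)) (Real.sqrt (z * zb)) ≤ D.fourPoint z zb ∧
      D.fourPoint z zb ≤ (D.fourPoint z z + D.fourPoint zb zb) / 2) ∧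
    (1 / 2 < z → 1 / 2 < zb →
      D.fourPoint z zb ≤ 1 + ((1 - ((1 - z) / z) ^ (2 * (1 / 8 : ℝ))) /
          (((1 - z) / z) ^ (2 * (1 / 8 : ℝ)) - ((1 - z) / z) ^ (99 / 100 : ℝ)) +
        (1 - ((1 - zb) / zb) ^ (2 * (1 / 8 : ℝ))) /
          (((1 - zb) / zb) ^ (2 * (1 / 8 : ℝ)) - ((1 - zb) / zb) ^ (99 / 100 : ℝ))) / 2) := by
  have hx : (99 / 100 : ℝ) < x := ((twoSided_2d_kernel099 w) D hU hC hT x hwx hS).1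
  have hτ : ∀ i, (99 / 100 : ℝ) ≤ D.Δ i := fun i =>
    le_trans (le_min (le_min hx.le (by norm_num)) (by norm_num)) (CrossingData.lowerBound_of_location hU hS i)
  have hτ₀ : 2 * (1 / 8 : ℝ) < 99 / 100 := by norm_num
  have hs : (0 : ℝ) < 1 / 8 := by norm_num
  have h := CrossingData.fourPoint_sandwich hU hC hs hz hzb
  refine ⟨⟨h.1, h.2.1⟩, fun hz2 hzb2 => ?_⟩
  exact CrossingData.fourPoint_le_arithMean_closed hU hC hτ hτ₀ hz2 hz.2 hzb2 hzb.2

end Summit.CriticalPhenomena.Ising3D.Control2D
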